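import Literature.NumberTheory.LFunctions.DirichletLOneLogBound
import Literature.NumberTheory.DiophantineGeometry.AbcWave0GranvilleStarkEq11Proofs
import Literature.NumberTheory.QuadraticFields.QuadraticDedekindZetaZeros
import Literature.NumberTheory.QuadraticFields.ClassNumberOneBakerInequality
import HarnessLib

/-!
# Oesterlé's elementary upper bound `h(−d) ≤ π⁻¹ √d log d` (Enseign. Math. 34 (1988), II §3 (27))

Topic `NumberTheory/QuadraticFields`, namespace `Literature.NumberTheory.QuadraticFields`.
Everything here is PROVED (theorems only; no definitions, no named facts).

J. Oesterlé, *Le problème de Gauss sur le nombre de classes*, Enseign. Math. (2) 34 (1988) 43–67,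
II §3, p. 57:

> «On obtient cependant de façon élémentaire des majorations raisonnables de `h(−d)` (raisonnable
> signifiant avec l'exposant `½` que l'on attend pour `d`), de la forme `h(−d) ≤ C√d log d`. Par
> exemple : PROPOSITION. *On a pour `d > 4`* (27) `h(−d) ≤ π⁻¹ √d log d`.
> Compte tenu de (24) et (26), il revient au même de montrer que l'on a, en posant `χ(n) = (−d/n)`,
> `∑_{n=1}^∞ χ(n)/n ≤ log d`. Or, pour tout nombre réel `x > 0`, la somme `M(x) = ∑_{n ≤ x} χ(n)` est
> majorée par `N(x) = inf([x], [(d−1)/2])`, et l'on a donc, en intégrant par parties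
> `∑ χ(n)/n = ∫_{1⁻}^∞ dM(x)/x = ∫₁^∞ M(x)x⁻² dx ≤ ∫₁^∞ N(x)x⁻² dx = ∫_{1⁻}^∞ dN(x)/x
>  = ∑_{n ≤ [(d−1)/2]} 1/n ≤ log d`.»

Here `h(−d)` is the class number of the imaginary quadratic field `K = ℚ(i√d)` of discriminant `−d`
(Oesterlé's (23)–(26): `ζ_K = ζ·L(·, χ)`, residue `π h(−d)/√d` for `d > 4`), equivalently the number
of reduced primitive positive definite forms of discriminant `−d`
(`BinaryQuadraticForm.classNumber`, `= h_K` by `Quadratic.card_reducedForms_eq_classNumber`).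

The analytic half `∑ χ(n)/n ≤ ∑_{n ≤ [(d−1)/2]} 1/n ≤ log d` is
`Literature/NumberTheory/LFunctions/DirichletLOneLogBound.lean` (for every character `χ ≠ 1` mod `d`:
`DirichletAbel.norm_LFunction_one_le_harmonic`, `DirichletAbel.norm_LFunction_one_le_log`); this file
multiplies by the class number formula:

* `BinaryQuadraticForm.classNumber_neg_le_sqrt_mul_harmonic` — the printed intermediate
  `h(−d) ≤ π⁻¹ √d · ∑_{n ≤ [(d−1)/2]} 1/n` for every `d > 4` carrying an odd real primitive
  character `χ` (i.e. `−d` fundamental), via `L(1, χ) = π h(−d)/√d`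
  (`Literature.NumberTheory.DiophantineGeometry.LFunction_one_eq`);
* `BinaryQuadraticForm.classNumber_neg_le_sqrt_mul_log` — **(27) as printed: `h(−d) ≤ π⁻¹ √d log d`**;
* `Quadratic.classNumber_le_sqrt_mul_log` — the same on the field side: for every imaginary
  quadratic field `K` with `d_K < −4`, `h_K ≤ π⁻¹ √|d_K| log |d_K|` (Kronecker character `κ` mod
  `|d_K|` with `ζ_K = ζ·L(·, κ)`, `Quadratic.exists_kroneckerChar`; class number formula
  `L(1, κ) = 2π h_K/(w_K √|d_K|)`, `Quadratic.LFunction_one_eq_of_discr_neg_of_eq`; `w_K = 2`).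

Not covered: `d ∈ {3, 4}` (`w = 6, 4`; there `h = 1`), non-fundamental discriminants.

## References

* [Oesterle1988Gauss] J. Oesterlé, *Le problème de Gauss sur le nombre de classes*, Enseign. Math.
  (2) 34 (1988), 43–67: II §3, Proposition p. 57, (27); (24), (26) p. 56.
-/

noncomputable section

open Complex NumberField Module

namespace Literature.NumberTheory.QuadraticFields

open Literature.NumberTheory.LFunctions.DirichletAbel (norm_LFunction_one_le_harmonic
  norm_LFunction_one_le_log harmonic_le_log_two_mul_add_one)

/-! ### Forms side: `h(−d)` = number of reduced forms of discriminant `−d` -/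

namespace BinaryQuadraticForm

/-- **Oesterlé's chain up to the harmonic number**: for `d > 4` and `χ` the odd real primitive
character mod `d`, `h(−d) ≤ π⁻¹ √d · ∑_{n ≤ [(d−1)/2]} 1/n` — the class number formula
`L(1, χ) = π h(−d)/√d` ((24), (26)) and `∑ χ(n)/n ≤ ∑_{n ≤ [(d−1)/2]} 1/n`.
[cite: Oesterle1988Gauss, II §3, proof of the Proposition p. 57] -/
theorem classNumber_neg_le_sqrt_mul_harmonic {d : ℕ} [NeZero d] (hd : 4 < d)
    {χ : DirichletCharacter ℂ d} (hprim : χ.IsPrimitive) (hquad : χ.IsQuadratic) (hodd : χ.Odd) :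
    (classNumber (-(d : ℤ)) : ℝ) ≤ Real.pi⁻¹ * Real.sqrt d * (harmonic ((d - 1) / 2) : ℝ) := by
  have hd0 : (0 : ℝ) < d := by exact_mod_cast (by omega : 0 < d)
  have hsd : 0 < Real.sqrt d := Real.sqrt_pos.2 hd0
  have hχ1 : χ ≠ 1 := by
    intro h
    have h1 : χ (-1) = -1 := hodd
    rw [h, MulChar.one_apply isUnit_one.neg] at h1
    norm_num at h1
  have hB := norm_LFunction_one_le_harmonic χ hχ1
  rw [Literature.NumberTheory.DiophantineGeometry.LFunction_one_eq hd hprim hquad hodd, Complex.norm_real,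
    Real.norm_eq_abs, abs_of_nonneg (by positivity)] at hB
  -- `π h/√d ≤ H` ⇒ `h ≤ π⁻¹ √d H`
  rw [div_le_iff₀ hsd] at hB
  have hπ := Real.pi_pos
  calc (classNumber (-(d : ℤ)) : ℝ) = Real.pi⁻¹ * (Real.pi * classNumber (-(d : ℤ))) := by
        field_simp
    _ ≤ Real.pi⁻¹ * ((harmonic ((d - 1) / 2) : ℝ) * Real.sqrt d) :=
        mul_le_mul_of_nonneg_left hB (by positivity)
    _ = Real.pi⁻¹ * Real.sqrt d * (harmonic ((d - 1) / 2) : ℝ) := by ring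

/-- **Oesterlé 1988, II §3 Proposition, (27): `h(−d) ≤ π⁻¹ √d log d` for `d > 4`.** Here `d > 4`
carries an odd real primitive character `χ` mod `d` (equivalently `−d` is the discriminant of an
imaginary quadratic field `K`, the setting of Oesterlé's (23)–(26)), and `h(−d)` is the number of
reduced primitive positive definite forms of discriminant `−d` (`= h_K`). Proof as printed:
`h(−d) = π⁻¹ √d L(1, χ)` and `L(1, χ) ≤ ∑_{n ≤ [(d−1)/2]} 1/n ≤ log d`.
[cite: Oesterle1988Gauss, II §3 Proposition p. 57 (27)] -/
theorem classNumber_neg_le_sqrt_mul_log {d : ℕ} [NeZero d] (hd : 4 < d)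
    {χ : DirichletCharacter ℂ d} (hprim : χ.IsPrimitive) (hquad : χ.IsQuadratic) (hodd : χ.Odd) :
    (classNumber (-(d : ℤ)) : ℝ) ≤ Real.pi⁻¹ * Real.sqrt d * Real.log d := by
  refine (classNumber_neg_le_sqrt_mul_harmonic hd hprim hquad hodd).trans ?_
  refine mul_le_mul_of_nonneg_left ?_ (by positivity)
  refine (harmonic_le_log_two_mul_add_one _).trans (Real.log_le_log (by positivity) ?_)
  exact_mod_cast (by omega : 2 * ((d - 1) / 2) + 1 ≤ d)

end BinaryQuadraticForm

/-! ### Field side: `h_K ≤ π⁻¹ √|d_K| log |d_K|` for `d_K < −4` -/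

namespace Quadratic

variable {K : Type*} [Field K] [NumberField K]

/-- `w_K = 2` for an imaginary quadratic field with `d_K < −4` (only `±1` are units), through an
integral basis `(1, ω)` and `BakerLimitFormula.torsionOrder_eq_two`. [folklore] -/
private theorem torsionOrder_eq_two_of_discr_lt_neg_four (h2 : finrank ℚ K = 2)
    (hd : NumberField.discr K < -4) : Units.torsionOrder K = 2 := by
  obtain ⟨b, hb⟩ := exists_basis_zero_eq_one h2
  have hω := basis_one_mul_self_eq b hb
  have hDK := discr_eq_sq_add_four_mul b hb
  exact BakerLimitFormula.torsionOrder_eq_two b hb hω (by rw [← hDK]; exact hd)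

/-- **Oesterlé 1988, II §3 Proposition, (27), field side: `h_K ≤ π⁻¹ √|d_K| log |d_K|` for every
imaginary quadratic field `K` with `d_K < −4`.** With the Kronecker character `κ ≠ 1` mod `|d_K|`
(`ζ_K = ζ·L(·, κ)`), the class number formula `L(1, κ) = 2π h_K/(w_K √|d_K|)` ((24), (26); `w_K = 2`)
and `|L(1, κ)| ≤ log |d_K|` (`DirichletAbel.norm_LFunction_one_le_log`).
[cite: Oesterle1988Gauss, II §3 Proposition p. 57 (27)] -/
theorem classNumber_le_sqrt_mul_log (h2 : finrank ℚ K = 2) (hd : NumberField.discr K < -4) :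
    (classNumber K : ℝ) ≤
      Real.pi⁻¹ * Real.sqrt |(NumberField.discr K : ℝ)| * Real.log |(NumberField.discr K : ℝ)| := by
  obtain ⟨M, _, κ, hM, hκ, -, hfac⟩ := exists_kroneckerChar (K := K) h2
  have hneg : NumberField.discr K < 0 := by omega
  have hcnf := LFunction_one_eq_of_discr_neg_of_eq h2 hneg hκ (fun s hs => hfac s (by simpa using hs))
  have hw : (Units.torsionOrder K : ℝ) = 2 := by
    exact_mod_cast torsionOrder_eq_two_of_discr_lt_neg_four h2 hd
  have habs : |(NumberField.discr K : ℝ)| = (M : ℝ) := by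
    rw [← Int.cast_abs, Int.abs_eq_natAbs, Int.cast_natCast, hM]
  have hM4 : (4 : ℝ) < M := by
    rw [← habs]
    have : ((-4 : ℤ) : ℝ) > (NumberField.discr K : ℝ) := by exact_mod_cast hd
    push_cast at this
    rw [abs_of_neg (by linarith)]
    linarith
  have hsd : 0 < Real.sqrt (M : ℝ) := Real.sqrt_pos.2 (by linarith)
  have hB := norm_LFunction_one_le_log κ hκ
  rw [hcnf, Complex.norm_real, Real.norm_eq_abs, hw, habs,
    abs_of_nonneg (by positivity)] at hB
  -- `2π h/(2√d) ≤ log d` ⇒ `h ≤ π⁻¹ √d log d`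
  rw [div_le_iff₀ (by positivity)] at hB
  rw [habs]
  have hπ := Real.pi_pos
  calc (classNumber K : ℝ) = Real.pi⁻¹ * (2 * Real.pi * classNumber K) / 2 := by
        field_simp
    _ ≤ Real.pi⁻¹ * (Real.log M * (2 * Real.sqrt M)) / 2 := by
        gcongr
    _ = Real.pi⁻¹ * Real.sqrt M * Real.log M := by ring

end Quadratic

end Literature.NumberTheory.QuadraticFields

end
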